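import Literature.Probability.LatticeModels.KCSignConditionLimit
import HarnessLib

/-!
# Rays, first exits and first entries for the sign-condition configuration

Topic `Literature/Probability/LatticeModels`. Elementary planar tools for the construction of a
`KCSignConfig` (the continuum configuration of the Chelkak–Smirnov sign-condition argument):

* `firstExit`: the first parameter at which a ray `m + s d` from a point of an open set `Ω`
  leaves `Ω`, with its basic properties;
* `firstEntry`: the first time a path enters a closed set;
* nearest points of `Ωᶜ` in the Euclidean and in the `ℓ¹` norm (the end diamonds);
* the algebra of the fan of rays from a point of a sphere into the ball;
* the lattice direction closest to a given direction.

All `[folklore]`; no named fact.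
-/

noncomputable section

open Set Metric Filter Topology

namespace Literature.Probability.LatticeModels

open Site

/-! ### First exit of a ray from an open set -/

/-- The first parameter `s ≥ 0` with `m + s d ∉ Ω`. [folklore] -/
def firstExit (Ω : Set ℂ) (m d : ℂ) : ℝ := sInf {s : ℝ | 0 ≤ s ∧ m + (s : ℂ) * d ∉ Ω}

/-- Properties of the first exit: if `Ω` is open, `m ∈ Ω` and the ray leaves `Ω` at some
`s₀ ≥ 0`, then `0 < L ≤ s₀`, `m + L d ∉ Ω`, and `m + s d ∈ Ω` for `0 ≤ s < L`. [folklore] -/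
theorem firstExit_spec {Ω : Set ℂ} (hΩ : IsOpen Ω) {m d : ℂ} (hm : m ∈ Ω) {s₀ : ℝ} (hs₀ : 0 ≤ s₀) (hout : m + (s₀ : ℂ) * d ∉ Ω) :
    0 < firstExit Ω m d ∧ firstExit Ω m d ≤ s₀ ∧ m + (firstExit Ω m d : ℂ) * d ∉ Ω ∧
      ∀ s : ℝ, 0 ≤ s → s < firstExit Ω m d → m + (s : ℂ) * d ∈ Ω := by
  set S : Set ℝ := {s : ℝ | 0 ≤ s ∧ m + (s : ℂ) * d ∉ Ω} with hS
  have hne : S.Nonempty := ⟨s₀, hs₀, hout⟩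
  have hbdd : BddBelow S := ⟨0, fun s hs => hs.1⟩
  have hclosed : IsClosed S := by
    have : S = Ici 0 ∩ (fun s : ℝ => m + (s : ℂ) * d) ⁻¹' Ωᶜ := by ext s; simp [hS]
    rw [this]
    exact isClosed_Ici.inter (hΩ.isClosed_compl.preimage (by fun_prop))
  have hmem : firstExit Ω m d ∈ S := hclosed.csInf_mem hne hbdd
  have hle : firstExit Ω m d ≤ s₀ := csInf_le hbdd ⟨hs₀, hout⟩
  have hbelow : ∀ s : ℝ, 0 ≤ s → s < firstExit Ω m d → m + (s : ℂ) * d ∈ Ω := by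
    intro s hs0 hs
    by_contra h
    exact absurd (csInf_le hbdd ⟨hs0, h⟩) (not_le.2 hs)
  refine ⟨?_, hle, hmem.2, hbelow⟩
  rcases hmem.1.lt_or_eq with h | h
  · exact h
  · exact absurd (by simpa [← h] using hm) hmem.2

/-- The exit point of a ray is a boundary point of `Ω`. [folklore] -/
theorem firstExit_mem_frontier {Ω : Set ℂ} (hΩ : IsOpen Ω) {m d : ℂ} (hm : m ∈ Ω) {s₀ : ℝ} (hs₀ : 0 ≤ s₀) (hout : m + (s₀ : ℂ) * d ∉ Ω) :
    m + (firstExit Ω m d : ℂ) * d ∈ frontier Ω := by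
  obtain ⟨hL0, -, hLout, hbelow⟩ := firstExit_spec hΩ hm hs₀ hout
  rw [frontier_eq_closure_inter_closure]
  refine ⟨?_, subset_closure hLout⟩
  rw [Metric.mem_closure_iff]
  intro ε hε
  set L := firstExit Ω m d
  -- the point at parameter `L - η`, `η` small
  set η : ℝ := min (L / 2) (ε / (2 * (‖d‖ + 1))) with hη
  have hηpos : 0 < η := lt_min (by positivity) (by positivity)
  have hηL : η ≤ L / 2 := min_le_left _ _
  refine ⟨m + ((L - η : ℝ) : ℂ) * d, hbelow _ (by linarith) (by linarith), ?_⟩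
  rw [dist_eq_norm]
  have : m + (L : ℂ) * d - (m + ((L - η : ℝ) : ℂ) * d) = (η : ℂ) * d := by push_cast; ring
  rw [this, norm_mul, Complex.norm_real, Real.norm_eq_abs, abs_of_pos hηpos]
  have h1 : η ≤ ε / (2 * (‖d‖ + 1)) := min_le_right _ _
  have h2 : η * ‖d‖ ≤ ε / (2 * (‖d‖ + 1)) * ‖d‖ := mul_le_mul_of_nonneg_right h1 (norm_nonneg _)
  have h3 : ε / (2 * (‖d‖ + 1)) * ‖d‖ < ε := by
    rw [div_mul_eq_mul_div, div_lt_iff₀ (by positivity)]; nlinarith [norm_nonneg d]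
  linarith

/-! ### First entry of a path into a closed set -/

/-- The first time a path enters a closed set containing its endpoint. [folklore] -/
def firstEntry {x y : ℂ} (γ : Path x y) (K : Set ℂ) : unitInterval := ⟨sInf {t : ℝ | t ∈ Icc (0 : ℝ) 1 ∧ γ.extend t ∈ K}, by
  have hne : {t : ℝ | t ∈ Icc (0 : ℝ) 1 ∧ γ.extend t ∈ K}.Nonempty ∨ ¬ {t : ℝ | t ∈ Icc (0 : ℝ) 1 ∧ γ.extend t ∈ K}.Nonempty := em _
  rcases hne with hne | hne
  · have hb : BddBelow {t : ℝ | t ∈ Icc (0 : ℝ) 1 ∧ γ.extend t ∈ K} := ⟨0, fun t ht => ht.1.1⟩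
    obtain ⟨t, ht⟩ := hne
    exact ⟨le_csInf ⟨t, ht⟩ fun s hs => hs.1.1, (csInf_le hb ht).trans ht.1.2⟩
  · rw [Set.not_nonempty_iff_eq_empty.1 hne, Real.sInf_empty]; exact ⟨le_rfl, zero_le_one⟩⟩

/-- Properties of the first entry time into a closed set `K ∌ x`, `K ∋ y`: the path is in `K`
at that time and not before. [folklore] -/
theorem firstEntry_spec {x y : ℂ} (γ : Path x y) {K : Set ℂ} (hK : IsClosed K) (hy : y ∈ K) :
    γ (firstEntry γ K) ∈ K ∧ ∀ t : unitInterval, t < firstEntry γ K → γ t ∉ K := by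
  set S : Set ℝ := {t : ℝ | t ∈ Icc (0 : ℝ) 1 ∧ γ.extend t ∈ K} with hS
  have hne : S.Nonempty := ⟨1, ⟨zero_le_one, le_rfl⟩, by simpa using hy⟩
  have hb : BddBelow S := ⟨0, fun t ht => ht.1.1⟩
  have hclosed : IsClosed S := by
    have : S = Icc 0 1 ∩ γ.extend ⁻¹' K := by ext t; simp [hS]
    rw [this]; exact isClosed_Icc.inter (hK.preimage γ.continuous_extend)
  have hmem : sInf S ∈ S := hclosed.csInf_mem hne hb
  have hval : (firstEntry γ K : ℝ) = sInf S := rfl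
  constructor
  · have := hmem.2
    rwa [← hval, γ.extend_extends'] at this
  · intro t ht hγt
    have htS : (t : ℝ) ∈ S := ⟨⟨t.2.1, t.2.2⟩, by simpa [γ.extend_extends'] using hγt⟩
    have := csInf_le hb htS
    rw [← hval] at this
    exact absurd this (not_le.2 ht)

/-- First entry into a closed ball from outside: the entry point is on the sphere. [folklore] -/
theorem dist_firstEntry_eq {x y e : ℂ} (γ : Path x y) {r : ℝ} (hx : r < dist x e) (hy : dist y e ≤ r) :
    dist (γ (firstEntry γ (closedBall e r))) e = r ∧ ∀ t : unitInterval, t < firstEntry γ (closedBall e r) → r < dist (γ t) e := by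
  obtain ⟨hin, hbefore⟩ := firstEntry_spec γ isClosed_closedBall (mem_closedBall.2 hy)
  have hbefore' : ∀ t : unitInterval, t < firstEntry γ (closedBall e r) → r < dist (γ t) e := fun t ht => by
    have := hbefore t ht; rwa [mem_closedBall, not_le] at this
  refine ⟨le_antisymm (mem_closedBall.1 hin) ?_, hbefore'⟩
  -- the entry time is positive (since `x` is outside), and the distance is `> r` just before
  set t₀ := firstEntry γ (closedBall e r)
  have ht₀pos : 0 < (t₀ : ℝ) := by
    by_contra h
    push Not at h
    have : t₀ = 0 := le_antisymm (by exact_mod_cast h) t₀.2.1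
    have hx' := mem_closedBall.1 hin
    rw [this, γ.source] at hx'
    linarith
  -- continuity of `t ↦ dist (γ t) e` at `t₀` from the left
  have hmem : t₀ ∈ closure {t : unitInterval | t < t₀} := by
    rw [Metric.mem_closure_iff]
    intro δ hδ
    set s : ℝ := max 0 ((t₀ : ℝ) - δ / 2) with hs
    have hs0 : 0 ≤ s := le_max_left _ _
    have hsle : s ≤ (t₀ : ℝ) := max_le ht₀pos.le (by linarith)
    have hslt : s < (t₀ : ℝ) := by rw [hs, max_lt_iff]; exact ⟨ht₀pos, by linarith⟩
    have hsge : (t₀ : ℝ) - δ / 2 ≤ s := le_max_right _ _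
    have hs1 : s ≤ 1 := hsle.trans t₀.2.2
    refine ⟨⟨s, hs0, hs1⟩, show (⟨s, hs0, hs1⟩ : unitInterval) < t₀ from Subtype.coe_lt_coe.1 hslt, ?_⟩
    rw [Subtype.dist_eq, Real.dist_eq, abs_of_nonneg (by show 0 ≤ (t₀ : ℝ) - s; linarith)]
    show (t₀ : ℝ) - s < δ
    linarith
  have hge : r ≤ dist (γ t₀) e := by
    have hclosed : IsClosed {t : unitInterval | r ≤ dist (γ t) e} := isClosed_le continuous_const (by fun_prop)
    exact closure_minimal (fun t (ht : t < t₀) => (hbefore' t ht).le) hclosed hmem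
  exact hge

/-! ### Nearest points of the complement -/

/-- For `z` in an open set `Ω ≠ univ` there is a nearest point of `Ωᶜ`, at distance
`infDist z Ωᶜ > 0`, and it is a boundary point. [folklore] -/
theorem exists_nearest_compl {Ω : Set ℂ} (hΩ : IsOpen Ω) (hne : Ωᶜ.Nonempty) {z : ℂ} (hz : z ∈ Ω) :
    ∃ q, q ∈ frontier Ω ∧ q ∉ Ω ∧ dist z q = infDist z Ωᶜ ∧ 0 < infDist z Ωᶜ ∧ ball z (infDist z Ωᶜ) ⊆ Ω := by
  have hclosed : IsClosed Ωᶜ := hΩ.isClosed_compl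
  obtain ⟨q, hq, hqd⟩ := hclosed.exists_infDist_eq_dist hne z
  have hpos : 0 < infDist z Ωᶜ := by
    rw [← hclosed.notMem_iff_infDist_pos hne]; exact fun h => h hz
  have hball : ball z (infDist z Ωᶜ) ⊆ Ω := fun w hw => by
    by_contra h
    have := infDist_le_dist_of_mem (x := z) (show w ∈ Ωᶜ from h)
    rw [mem_ball, dist_comm] at hw
    linarith
  refine ⟨q, ?_, hq, hqd.symm, hpos, hball⟩
  rw [frontier_eq_closure_inter_closure]
  refine ⟨?_, subset_closure hq⟩
  rw [Metric.mem_closure_iff]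
  intro ε hε
  -- points of the open segment from `q` to `z` near `q` are in the ball, hence in `Ω`
  set η : ℝ := min (1 / 2) (ε / (2 * (dist z q + 1))) with hη
  have hη0 : 0 < η := lt_min (by norm_num) (by positivity)
  have hη1 : η ≤ 1 / 2 := min_le_left _ _
  refine ⟨q + (η : ℂ) * (z - q), hball ?_, ?_⟩
  · rw [mem_ball, dist_eq_norm]
    have : q + (η : ℂ) * (z - q) - z = ((1 - η : ℝ) : ℂ) * (q - z) := by push_cast; ring
    rw [this, norm_mul, Complex.norm_real, Real.norm_eq_abs, abs_of_pos (by linarith), ← dist_eq_norm, dist_comm, hqd]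
    exact mul_lt_of_lt_one_left (by rwa [← hqd]) (by linarith)
  · rw [dist_eq_norm]
    have : q - (q + (η : ℂ) * (z - q)) = -((η : ℂ) * (z - q)) := by ring
    rw [this, norm_neg, norm_mul, Complex.norm_real, Real.norm_eq_abs, abs_of_pos hη0, ← dist_eq_norm]
    have h1 : η ≤ ε / (2 * (dist z q + 1)) := min_le_right _ _
    have h2 := dist_nonneg (x := z) (y := q)
    calc η * dist z q ≤ ε / (2 * (dist z q + 1)) * dist z q := mul_le_mul_of_nonneg_right h1 h2
      _ < ε := by rw [div_mul_eq_mul_div, div_lt_iff₀ (by positivity)]; nlinarith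

/-- **The `ℓ¹`-nearest point of the complement.** For `z` in an open set `Ω` with bounded…
nonempty complement there is `p ∉ Ω` minimising `l1norm (p - z)`; the open `ℓ¹`-diamond of
that radius lies in `Ω`, and the radius is positive. [folklore] -/
theorem exists_l1nearest_compl {Ω : Set ℂ} (hΩ : IsOpen Ω) (hne : Ωᶜ.Nonempty) {z : ℂ} (hz : z ∈ Ω) :
    ∃ p, p ∉ Ω ∧ 0 < l1norm (p - z) ∧ {w | l1norm (w - z) < l1norm (p - z)} ⊆ Ω ∧ ∀ p', p' ∉ Ω → l1norm (p - z) ≤ l1norm (p' - z) := by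
  obtain ⟨p₀, hp₀⟩ := hne
  -- minimise the continuous coercive function `l1norm (· - z)` over the closed set `Ωᶜ`
  set K : Set ℂ := Ωᶜ ∩ {w | l1norm (w - z) ≤ l1norm (p₀ - z)} with hK
  have hcont : Continuous fun w : ℂ => l1norm (w - z) := by unfold l1norm; fun_prop
  have hKc : IsCompact K := by
    refine (isCompact_closedBall z (l1norm (p₀ - z))).of_isClosed_subset (hΩ.isClosed_compl.inter (isClosed_le hcont continuous_const)) ?_
    rintro w ⟨-, hw⟩
    rw [mem_closedBall, dist_eq_norm]
    exact (norm_le_l1norm _).trans hw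
  have hKne : K.Nonempty := ⟨p₀, hp₀, le_refl (l1norm (p₀ - z))⟩
  obtain ⟨p, ⟨hpΩ, hpK⟩, hpmin⟩ := hKc.exists_isMinOn hKne hcont.continuousOn
  have hmin : ∀ p', p' ∉ Ω → l1norm (p - z) ≤ l1norm (p' - z) := by
    intro p' hp'
    rcases le_or_gt (l1norm (p' - z)) (l1norm (p₀ - z)) with h | h
    · exact hpmin ⟨hp', h⟩
    · exact hpK.trans h.le
  refine ⟨p, hpΩ, ?_, fun w hw => ?_, hmin⟩
  · obtain ⟨q, -, -, hqd, hpos, hball⟩ := exists_nearest_compl hΩ ⟨p₀, hp₀⟩ hz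
    have : p ∉ ball z (infDist z Ωᶜ) := fun h => hpΩ (hball h)
    rw [mem_ball, not_lt, dist_eq_norm] at this
    exact lt_of_lt_of_le (lt_of_lt_of_le hpos this) (norm_le_l1norm _)
  · by_contra h
    exact absurd (hmin w h) (not_le.2 hw)

/-! ### The fan of rays from a point of a sphere -/

/-- The inner product with a unit vector as a real number: `⟪w, d⟫ = Re (w · conj d)`. [folklore] -/
def rdot (w d : ℂ) : ℝ := (w * (starRingEnd ℂ) d).re

/-- `rdot` in coordinates. [folklore] -/
theorem rdot_eq (w d : ℂ) : rdot w d = w.re * d.re + w.im * d.im := by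
  simp only [rdot, Complex.mul_re, Complex.conj_re, Complex.conj_im]; ring

/-- `‖m + s d - e‖² = ρ² - 2 s ⟪e - m, d⟫ + s²` for `‖m - e‖ = ρ`, `‖d‖ = 1`. [folklore] -/
theorem norm_sq_ray_sub (m e d : ℂ) (hd : ‖d‖ = 1) (s : ℝ) :
    ‖m + (s : ℂ) * d - e‖ ^ 2 = ‖m - e‖ ^ 2 - 2 * s * rdot (e - m) d + s ^ 2 := by
  have hd2 : d.re ^ 2 + d.im ^ 2 = 1 := by
    have h := congrArg (· ^ 2) hd
    simp only [one_pow] at h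
    rw [Complex.sq_norm, Complex.normSq_apply] at h
    nlinarith [h]
  rw [Complex.sq_norm, Complex.sq_norm, Complex.normSq_apply, Complex.normSq_apply, rdot_eq]
  simp only [Complex.sub_re, Complex.sub_im, Complex.add_re, Complex.add_im, Complex.mul_re, Complex.mul_im,
    Complex.ofReal_re, Complex.ofReal_im, zero_mul, sub_zero, add_zero]
  nlinarith [hd2]

/-- **Rays of the fan stay in the open ball and reach the inner ball.** If `‖m - e‖ = ρ`,
`‖d‖ = 1` and `⟪e - m, d⟫ = ρ α` with `α > 0`, then `m + s d ∈ ball e ρ` for `0 < s < 2 ρ α`,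
and `‖m + ρ α d - e‖² = ρ² (1 - α²)`. [folklore] -/
theorem ray_mem_ball {m e d : ℂ} {ρ α : ℝ} (hme : ‖m - e‖ = ρ) (hd : ‖d‖ = 1) (hα : rdot (e - m) d = ρ * α)
    {s : ℝ} (hs0 : 0 < s) (hs : s < 2 * ρ * α) : m + (s : ℂ) * d ∈ ball e ρ := by
  rw [mem_ball, dist_eq_norm]
  have h := norm_sq_ray_sub m e d hd s
  rw [hme, hα] at h
  have hρ : 0 ≤ ρ := hme ▸ norm_nonneg _
  nlinarith [norm_nonneg (m + (s : ℂ) * d - e)]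

/-- The point of the ray at parameter `ρ α`. [folklore] -/
theorem norm_sq_ray_mid {m e d : ℂ} {ρ α : ℝ} (hme : ‖m - e‖ = ρ) (hd : ‖d‖ = 1) (hα : rdot (e - m) d = ρ * α) :
    ‖m + ((ρ * α : ℝ) : ℂ) * d - e‖ ^ 2 = ρ ^ 2 * (1 - α ^ 2) := by
  have h := norm_sq_ray_sub m e d hd (ρ * α)
  rw [hme, hα] at h
  rw [h]; ring

/-! ### The lattice direction closest to a direction -/

/-- `rdot w (dirVec k) = dirCoord k w`. [folklore] -/
theorem rdot_dirVec (w : ℂ) (k : Fin 4) : rdot w (dirVec k) = dirCoord k w := by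
  rw [rdot_eq, dirCoord, dirVec_re, dirVec_im]

/-- **The closest lattice direction**: for every `c` there is `k` with
`|dirCoord (k+1) c| ≤ dirCoord k c`. [folklore] -/
theorem exists_closest_dir (c : ℂ) : ∃ k : Fin 4, |dirCoord (k + 1) c| ≤ dirCoord k c := by
  -- `dirCoord (k+2) = -dirCoord k`; pick the largest of the four coordinates
  have hneg : ∀ k : Fin 4, dirCoord (k + 2) c = -dirCoord k c := fun k => by
    obtain ⟨h0, h1⟩ := cornerUnit_succ_apply k
    obtain ⟨h0', h1'⟩ := cornerUnit_succ_apply (k + 1)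
    rw [show k + 2 = k + 1 + 1 from by rw [add_assoc]; rfl]
    simp only [dirCoord, h0', h1', h0, h1, Int.cast_neg]; ring
  set a := dirCoord 0 c with ha
  set b := dirCoord 1 c with hb
  have h2 : dirCoord 2 c = -a := hneg 0
  have h3 : dirCoord 3 c = -b := by simpa using hneg 1
  by_cases hab : |b| ≤ a
  · exact ⟨0, by simpa using hab⟩
  by_cases hba : |a| ≤ b
  · exact ⟨1, by rw [show (1 : Fin 4) + 1 = 2 from rfl, h2, abs_neg]; exact hba⟩
  by_cases hab' : |b| ≤ -a
  · exact ⟨2, by rw [show (2 : Fin 4) + 1 = 3 from rfl, h3, h2, abs_neg]; exact hab'⟩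
  refine ⟨3, ?_⟩
  rw [show (3 : Fin 4) + 1 = 0 from rfl, h3]
  show |a| ≤ -b
  push Not at hab hba hab'
  have h1 : |a| < |b| := abs_lt.2 ⟨by linarith, hab⟩
  have hb0 : b < 0 := by
    by_contra h; push Not at h
    rw [abs_of_nonneg h] at h1; linarith
  rw [abs_of_neg hb0] at h1
  exact h1.le

/-- For the closest lattice direction, `dirCoord k c ≥ ‖c‖/√2` (indeed `2 (dirCoord k c)² ≥ ‖c‖²`). [folklore] -/
theorem two_mul_sq_dirCoord_ge {c : ℂ} {k : Fin 4} (h : |dirCoord (k + 1) c| ≤ dirCoord k c) : ‖c‖ ^ 2 ≤ 2 * dirCoord k c ^ 2 := by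
  have hsum : dirCoord k c ^ 2 + dirCoord (k + 1) c ^ 2 = ‖c‖ ^ 2 := by
    obtain ⟨h0, h1⟩ := cornerUnit_succ_apply k
    have hn : (cornerUnit k 0 : ℝ) ^ 2 + (cornerUnit k 1 : ℝ) ^ 2 = 1 := by
      rcases cornerUnit_apply_cases k with ⟨e0, e1⟩ | ⟨e0, e1⟩ | ⟨e0, e1⟩ | ⟨e0, e1⟩ <;> simp [e0, e1]
    rw [Complex.sq_norm, Complex.normSq_apply]
    simp only [dirCoord, h0, h1, Int.cast_neg]
    linear_combination (c.re ^ 2 + c.im ^ 2) * hn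
  have : dirCoord (k + 1) c ^ 2 ≤ dirCoord k c ^ 2 := by
    rw [← sq_abs (dirCoord (k + 1) c)]
    exact pow_le_pow_left₀ (abs_nonneg _) h 2
  linarith

end Literature.Probability.LatticeModels
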